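import Summits.CriticalPhenomena.PercolationContinuityZ3.Theorems.PercNearOneGluingNoHeavyLowerTailAntitheticLiftComposition
import HarnessLib

/-!
# `NoHeavyLowerTail` (stmt-CriticalPhenomena-4575) — antithetic cluster pairs: LIFT COMPOSITION FOR THE SHIFTED-BIC CLASS
# (the abstract Harris-averaging lemma of gen 64 with the test class `𝒮_shift = {F⁺(X) − F⁻(Y) : F⁻ ≤ F⁺ monotone}` in hypothesis AND
# conclusion; prim-hp-2 gen 65, HOME/MEMO-gen65.md §2(d))

Support file (`--supports stmt-CriticalPhenomena-4575`, hull-port prover `prim-hp-2`, gen 65).  No definitions, no named facts, no sorries;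
standard axioms.  Purely abstract (finite sums).

WHY.  The programme's currency since gen 56 is the class 𝒮 of twisted-monotone SUPER-ODD test functions; gen 65 found that `K_{2,4}` from a
pole is ⊕-positive for the BIC class `F(X) − F(Y)` of the conjecture but NOT for 𝒮 (…AntitheticK24NotOplus).  Between the two sits
`𝒮_shift`: functions `K(X, Y) = F⁺(X) − F⁻(Y)` with `F⁻, F⁺` monotone and `F⁻ ≤ F⁺` pointwise — exactly what the degree-2 reduction
produces from BIC functions (`F(X ∪ {x}) − F(Y)`), and exactly what the pendant reductions produce from those (one argument lifted at a time).
`𝒮_shift ⊂ 𝒮` (super-oddness: `F⁺(X) − F⁻(Y) + F⁺(Y) − F⁻(X) ≥ 0`), and — the point of this file — `𝒮_shift` is CLOSED under averaging over a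
red-dominated cube of lift maps: with `Φ_T, Ψ_T` as in `Antithetic.lift_composition_sum_nonneg` (`Ψ_{Tᶜ} P ⊆ Φ_T P`),
`Σ_T [F⁺(Φ_T P) − F⁻(Ψ_T Q)] = F̃⁺(P) − F̃⁻(Q)` with `F̃⁺ = Σ_T F⁺∘Φ_T`, `F̃⁻ = Σ_T F⁻∘Ψ_T` monotone and
`F̃⁻(P) = Σ_T F⁻(Ψ_{Tᶜ} P) ≤ Σ_T F⁻(Φ_T P) ≤ F̃⁺(P)`.  So the lift-composition lemma holds with `𝒮_shift` on BOTH sides: a WEAKER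
hypothesis on side 1 (positivity for shifted-BIC pairs only) gives the (weaker, but BIC-sufficient) conclusion for shifted-BIC pairs.  This is
the abstract core of a possible re-basing of the 1-sum lemma / THEOREM S½ / handle theorems on `𝒮_shift` (MEMO-gen65 §5 (P3)); whether it
gains anything is decided by exact `𝒮_shift`-positivity tests of cores such as `K_{2,4}` (kit65/shift).
* `Antithetic.lift_composition_shift_sum_nonneg` — the lemma; `Antithetic.lift_composition_shift_filter_nonneg` — `Finset.filter` form.
[cite: VandenbergHaggstromKahn2005, §1 p. 6 ("Harris' inequality")]
-/

noncomputable section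

namespace Summit.CriticalPhenomena.PercolationContinuityZ3.Theorems

open scoped Classical

namespace Antithetic

variable {V : Type*} {ι : Type*} [Fintype ι]

/-- **Lift composition in the shifted-BIC class.**  Side 1: a finite family of pairs `(P₁ j, Q₁ j)` on which
`Σ_j (F⁺(P₁ j) − F⁻(Q₁ j))(G⁺(P₁ j) − G⁻(Q₁ j)) ≥ 0` for all monotone `F⁻ ≤ F⁺`, `G⁻ ≤ G⁺`.  Side 2: lift maps `Φ T, Ψ T` (`T : Set ι`),
monotone in the set, `Φ` monotone / `Ψ` antitone in `T`, with `Ψ Tᶜ P ⊆ Φ T P`.  Then for all monotone `F⁻ ≤ F⁺`, `G⁻ ≤ G⁺`: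
`0 ≤ Σ_j Σ_T (F⁺(Φ T (P₁ j)) − F⁻(Ψ T (Q₁ j))) · (G⁺(Φ T (P₁ j)) − G⁻(Ψ T (Q₁ j)))`. [this work] -/
theorem lift_composition_shift_sum_nonneg {J : Type*} [Fintype J] (P₁ Q₁ : J → Set V)
    (hplus : ∀ Fp Fm Gp Gm : Set V → ℝ, Monotone Fp → Monotone Fm → (∀ S, Fm S ≤ Fp S) →
      Monotone Gp → Monotone Gm → (∀ S, Gm S ≤ Gp S) →
      0 ≤ ∑ j, (Fp (P₁ j) - Fm (Q₁ j)) * (Gp (P₁ j) - Gm (Q₁ j)))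
    (Φ Ψ : Set ι → Set V → Set V) (hΦP : ∀ T, Monotone (Φ T)) (hΨP : ∀ T, Monotone (Ψ T))
    (hΦT : ∀ P, Monotone (fun T => Φ T P)) (hΨT : ∀ Q, Antitone (fun T => Ψ T Q)) (hdom : ∀ T P, Ψ Tᶜ P ⊆ Φ T P)
    {Fp Fm Gp Gm : Set V → ℝ} (hFp : Monotone Fp) (hFm : Monotone Fm) (hF : ∀ S, Fm S ≤ Fp S)
    (hGp : Monotone Gp) (hGm : Monotone Gm) (hG : ∀ S, Gm S ≤ Gp S) :
    0 ≤ ∑ j, ∑ T : Set ι, (Fp (Φ T (P₁ j)) - Fm (Ψ T (Q₁ j))) * (Gp (Φ T (P₁ j)) - Gm (Ψ T (Q₁ j))) := by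
  -- the cube-averaged one-set functions
  let Fp' : Set V → ℝ := fun P => ∑ T : Set ι, Fp (Φ T P)
  let Fm' : Set V → ℝ := fun Q => ∑ T : Set ι, Fm (Ψ T Q)
  let Gp' : Set V → ℝ := fun P => ∑ T : Set ι, Gp (Φ T P)
  let Gm' : Set V → ℝ := fun Q => ∑ T : Set ι, Gm (Ψ T Q)
  have hsumc : ∀ (c : Set ι → ℝ), ∑ T : Set ι, c Tᶜ = ∑ T : Set ι, c T := fun c =>
    Fintype.sum_equiv (Equiv.mk compl compl compl_compl compl_compl) _ _ fun T => rfl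
  -- monotone …
  have hmonoP : ∀ {F : Set V → ℝ}, Monotone F → Monotone (fun P => ∑ T : Set ι, F (Φ T P)) :=
    fun hFmono P P' hP => Finset.sum_le_sum fun T _ => hFmono (hΦP T hP)
  have hmonoQ : ∀ {F : Set V → ℝ}, Monotone F → Monotone (fun Q => ∑ T : Set ι, F (Ψ T Q)) :=
    fun hFmono Q Q' hQ => Finset.sum_le_sum fun T _ => hFmono (hΨP T hQ)
  -- … and nested: `Σ_T F⁻(Ψ_T P) = Σ_T F⁻(Ψ_{Tᶜ} P) ≤ Σ_T F⁻(Φ_T P) ≤ Σ_T F⁺(Φ_T P)` (domination, then `F⁻ ≤ F⁺`)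
  have hnest : ∀ {Fa Fb : Set V → ℝ}, Monotone Fb → (∀ S, Fb S ≤ Fa S) →
      ∀ P, (∑ T : Set ι, Fb (Ψ T P)) ≤ ∑ T : Set ι, Fa (Φ T P) := by
    intro Fa Fb hFb hab P
    rw [← hsumc (fun T => Fb (Ψ T P))]
    exact Finset.sum_le_sum fun T _ => (hFb (hdom T P)).trans (hab _)
  have hpos := hplus Fp' Fm' Gp' Gm' (hmonoP hFp) (hmonoQ hFm) (hnest hFm hF) (hmonoP hGp) (hmonoQ hGm) (hnest hGm hG)
  -- Harris in `T` for each `j`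
  have hN : (0 : ℝ) < (Fintype.card (Set ι) : ℝ) := by exact_mod_cast Fintype.card_pos
  have hj : ∀ j, (Fp' (P₁ j) - Fm' (Q₁ j)) * (Gp' (P₁ j) - Gm' (Q₁ j)) ≤ (Fintype.card (Set ι) : ℝ) *
      ∑ T : Set ι, (Fp (Φ T (P₁ j)) - Fm (Ψ T (Q₁ j))) * (Gp (Φ T (P₁ j)) - Gm (Ψ T (Q₁ j))) := by
    intro j
    have e1 : Fp' (P₁ j) - Fm' (Q₁ j) = ∑ T : Set ι, (Fp (Φ T (P₁ j)) - Fm (Ψ T (Q₁ j))) := by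
      show (∑ T : Set ι, Fp (Φ T (P₁ j))) - (∑ T : Set ι, Fm (Ψ T (Q₁ j))) = _
      rw [← Finset.sum_sub_distrib]
    have e2 : Gp' (P₁ j) - Gm' (Q₁ j) = ∑ T : Set ι, (Gp (Φ T (P₁ j)) - Gm (Ψ T (Q₁ j))) := by
      show (∑ T : Set ι, Gp (Φ T (P₁ j))) - (∑ T : Set ι, Gm (Ψ T (Q₁ j))) = _
      rw [← Finset.sum_sub_distrib]
    rw [e1, e2]
    refine harris_uniform_cov (a := fun T => Fp (Φ T (P₁ j)) - Fm (Ψ T (Q₁ j)))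
      (b := fun T => Gp (Φ T (P₁ j)) - Gm (Ψ T (Q₁ j))) ?_ ?_
    · exact fun T T' hTT' => sub_le_sub (hFp (hΦT (P₁ j) hTT')) (hFm (hΨT (Q₁ j) hTT'))
    · exact fun T T' hTT' => sub_le_sub (hGp (hΦT (P₁ j) hTT')) (hGm (hΨT (Q₁ j) hTT'))
  have hsum : ∑ j, (Fp' (P₁ j) - Fm' (Q₁ j)) * (Gp' (P₁ j) - Gm' (Q₁ j)) ≤ (Fintype.card (Set ι) : ℝ) *
      ∑ j, ∑ T : Set ι, (Fp (Φ T (P₁ j)) - Fm (Ψ T (Q₁ j))) * (Gp (Φ T (P₁ j)) - Gm (Ψ T (Q₁ j))) := by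
    rw [Finset.mul_sum]
    exact Finset.sum_le_sum fun j _ => hj j
  exact (mul_nonneg_iff_of_pos_left hN).1 (le_trans hpos hsum)

/-- **Lift composition in the shifted-BIC class, `Finset.filter` form of side 1** (the shape of the colouring sums). [this work] -/
theorem lift_composition_shift_filter_nonneg {J : Type*} [Fintype J] (p : J → Prop) [DecidablePred p] (P₁ Q₁ : J → Set V)
    (hplus : ∀ Fp Fm Gp Gm : Set V → ℝ, Monotone Fp → Monotone Fm → (∀ S, Fm S ≤ Fp S) →
      Monotone Gp → Monotone Gm → (∀ S, Gm S ≤ Gp S) →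
      0 ≤ ∑ j ∈ Finset.univ.filter (fun j => p j), (Fp (P₁ j) - Fm (Q₁ j)) * (Gp (P₁ j) - Gm (Q₁ j)))
    (Φ Ψ : Set ι → Set V → Set V) (hΦP : ∀ T, Monotone (Φ T)) (hΨP : ∀ T, Monotone (Ψ T))
    (hΦT : ∀ P, Monotone (fun T => Φ T P)) (hΨT : ∀ Q, Antitone (fun T => Ψ T Q)) (hdom : ∀ T P, Ψ Tᶜ P ⊆ Φ T P)
    {Fp Fm Gp Gm : Set V → ℝ} (hFp : Monotone Fp) (hFm : Monotone Fm) (hF : ∀ S, Fm S ≤ Fp S)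
    (hGp : Monotone Gp) (hGm : Monotone Gm) (hG : ∀ S, Gm S ≤ Gp S) :
    0 ≤ ∑ j ∈ Finset.univ.filter (fun j => p j), ∑ T : Set ι,
      (Fp (Φ T (P₁ j)) - Fm (Ψ T (Q₁ j))) * (Gp (Φ T (P₁ j)) - Gm (Ψ T (Q₁ j))) := by
  have hsub : ∀ (f : J → ℝ), ∑ j ∈ Finset.univ.filter (fun j => p j), f j = ∑ j : {j : J // p j}, f j.1 :=
    fun f => Finset.sum_subtype _ (fun j => by simp only [Finset.mem_filter, Finset.mem_univ, true_and]) f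
  rw [hsub]
  refine lift_composition_shift_sum_nonneg (fun j : {j : J // p j} => P₁ j.1) (fun j => Q₁ j.1) ?_ Φ Ψ hΦP hΨP hΦT hΨT hdom
    hFp hFm hF hGp hGm hG
  intro Fp' Fm' Gp' Gm' h1 h2 h3 h4 h5 h6
  have h := hplus Fp' Fm' Gp' Gm' h1 h2 h3 h4 h5 h6
  rw [hsub (fun j => (Fp' (P₁ j) - Fm' (Q₁ j)) * (Gp' (P₁ j) - Gm' (Q₁ j)))] at h
  exact h

end Antithetic

end Summit.CriticalPhenomena.PercolationContinuityZ3.Theorems
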